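import Literature.AlgebraicGeometry.AbelianSchemes.AbelianLiftObstructionVanishesOfIsUnitTwo
import Literature.AlgebraicGeometry.AbelianSchemes.AbelianSchemeLiftOfObstructionVanishes
import Literature.AlgebraicGeometry.AbelianVarieties.CechH1DimOfCharZeroByTransport
import HarnessLib

/-!
# Abelian schemes lift along nilpotent thickenings of Artinian local rings when `2` is a unit, `H¹`-count as hypothesis
# ([Oort1971] Thm. (2.2.1), first proof; [MumfordFogartyKirwan1994] Prop. 6.15; [MumfordAV1970] §13 Cor. 2)

Layer `Literature/AlgebraicGeometry/AbelianSchemes`, namespace `Literature.AlgebraicGeometry.AbelianSchemes.AbelianSchemeOver`.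
PROOF FILE (cell `hodgecm-mathlib`, P6 sub-desk P6b, (U-ab) plate organ **(O7) «ABELIAN LIFT WHEN 2 IS A UNIT, H¹-COUNT AS HYPOTHESIS»**
= ★ FC-4 ∘ (O6), desk F0P6b-plan (g9) deal 2026-09-02T22:18:03Z to LA3-p01 (g6); count-neutral ★ capital on `--supports stmt-HodgeConjecture-24832`;
no definition, no instance, no notation, no named fact, no `sorry`).  Statement boxed «=» by the desk (sigtwin v1 27efa0aba65cf1c1, 2026-09-02T22:21:26Z;
head (b)'s `2 ∈ Aˣ` binder derived inside per the desk's remark).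

THE PRINT. [Oort1971, Thm. (2.2.1) (p. 273)] (Grothendieck): the local moduli functor of an abelian variety is formally smooth — every abelian scheme
over `R′ = R⧸J` lifts to `R`; first proof (pp. 279–280): the obstruction `D(X′; R → R′) ∈ H²(X_k, Θ) ⊗ J` is canonical, the inversion acts on it by
`−1` («if char(k) ≠ 2, this proves the obstruction vanishes»), using `H²(X_k, 𝒪) = ∧² H¹(X_k, 𝒪)` ([MumfordAV1970] §13 Cor. 2); then the identity
section and the group law lift ([MumfordFogartyKirwan1994] Ch. 6 §3 Prop. 6.15).  HERE: ★ FC-4 `exists_abelianLift_of_liftObstructionVanishes`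
(flag of principal small rungs `A⧸J′ → A⧸J″`, FC-2 one-step lift of the scheme + identity + law at each rung) with its rung hypothesis `hvan`
discharged by ★ (O6) `liftObstructionVanishes_of_isUnit_two` — `2 ∈ (A⧸J′)ˣ` descends from `2 ∈ Aˣ`, and the `H¹`-COUNT `dim B ≤ dim_k Ȟ¹(𝔙, 𝒪_B) + 1`
is needed for the canonical closed fibre of EVERY abelian `Y₀` of relative dimension `g` at EVERY rung (FC-4 quantifies `hvan` over all of them), so
the head takes it for all abelian schemes over all fields (`hH1`, HONEST LABEL: the theorem is CONDITIONAL on it; ★ today for residue characteristic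
`0` — second head `…_of_charZero`, by ★ `AbelianVarieties.finrank_cechH1_structureSheaf_eq_dim_of_charZero` — and for DUALS-letter data
★ `MumfordDual.finite_finrank_cechH1_eq_dim_of_letter_field`; OPEN in the tree for a bare abelian variety in characteristic `p`).  The small-extension
binder `𝔪_A · J = 0` of the banked socket `…F0P6bBTSerreTate.stub_L4B1u_abelianLiftOfIsUnitTwo` is not needed (FC-4 lifts along any `J₀ ≠ ⊤`, `A` Artinian).

HC_CM is proved only modulo the printed citations until rung 0 closes; nothing here bears on a summit statement.
## References
* [Oort1971] F. Oort, *Finite group schemes, local moduli for abelian varieties, and lifting problems*, Compositio Math. 23 (1971), Thm. (2.2.1)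
  (p. 273) and its first proof (pp. 277–280).
* [MumfordFogartyKirwan1994] D. Mumford, J. Fogarty, F. Kirwan, *Geometric Invariant Theory*, 3rd ed. (1994), Ch. 6 §3 Proposition 6.15.
* [MumfordAV1970] D. Mumford, *Abelian Varieties* (1970), §13 Cor. 2 (p. 129).
-/

noncomputable section

open CategoryTheory CategoryTheory.Limits AlgebraicGeometry
open Literature.AlgebraicGeometry.Morphisms (CechH1)

namespace Literature.AlgebraicGeometry.AbelianSchemes.AbelianSchemeOver

variable {A : Type} [CommRing A] [IsArtinianRing A] [IsLocalRing A]

/-- **[Oort1971] Thm. (2.2.1) with `2 ∈ Aˣ`, `H¹`-count as hypothesis.**  `A` Artinian local with `2` a unit, `J₀ ≠ ⊤`, `X₀` an abelian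
scheme of relative dimension `g` over `Spec (A⧸J₀)`; GIVEN the `H¹`-count `dim B ≤ dim_k Ȟ¹(𝔙, 𝒪_B) + 1` for every abelian scheme `B` over every
field `k` and every finite affine open cover `𝔙` ([MumfordAV1970] §13 Cor. 2 — the hypothesis `hH1`; CONDITIONAL on it), there is an abelian scheme
`X` of relative dimension `g` over `Spec A` of which `X₀` is the base change along `Spec (A⧸J₀) ↪ Spec A` as a group scheme (★ `IsBaseChangeVia`).
★ FC-4 `exists_abelianLift_of_liftObstructionVanishes` ∘ ★ (O6) `liftObstructionVanishes_of_isUnit_two` at every principal small rung.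
[cite: Oort1971, Theorem (2.2.1) (p. 273) and pp. 277–280] [cite: MumfordFogartyKirwan1994, Ch. 6 §3 Proposition 6.15]
[cite: MumfordAV1970, §13 Cor. 2 (p. 129)] -/
theorem exists_abelianLift_of_isUnit_two (J₀ : Ideal A) (hJ₀ : J₀ ≠ ⊤) {g : ℕ} (h2 : IsUnit (2 : A))
    (hH1 : ∀ (k : Type) [Field k] (B : AbelianSchemeOver (Spec (.of k))) {ι : Type} [Finite ι] (V : ι → B.X.left.Opens),
      (∀ j, IsAffineOpen (V j)) → iSup V = ⊤ → B.toAffine.toAbelianVariety.dim ≤ Module.finrank k (CechH1 B.X.hom V) + 1)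
    (X₀ : AbelianSchemeOver (Spec (.of (A ⧸ J₀)))) (hg : X₀.IsOfRelDim g) :
    ∃ (X : AbelianSchemeOver (Spec (.of A))) (_ : X.IsOfRelDim g) (G : X₀.X.left ⟶ X.X.left),
      X₀.IsBaseChangeVia X (Spec.map (CommRingCat.ofHom (Ideal.Quotient.mk J₀))) G := by
  refine exists_abelianLift_of_liftObstructionVanishes J₀ hJ₀ (fun J J' t _ _ _ _ _ _ hI hL hmL φ Y₀ hY₀ => ?_) X₀ hg
  haveI := hI
  have h2' : IsUnit (2 : A ⧸ J') := by simpa only [map_ofNat] using h2.map (Ideal.Quotient.mk J')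
  exact liftObstructionVanishes_of_isUnit_two hL hmL φ Y₀ hY₀ h2' (fun V hV hVcov => hH1 _ _ V hV hVcov)

/-- **[Oort1971] Thm. (2.2.1) with `2 ∈ Aˣ`, RESIDUE CHARACTERISTIC `0` — unconditional.**  `A` Artinian local with residue field of
characteristic `0` (so `2 ∈ Aˣ`: `residue 2 = 2 ≠ 0`, Mathlib `IsLocalRing.residue_ne_zero_iff_isUnit`), `J₀ ≠ ⊤`, `X₀` abelian of relative
dimension `g` over `Spec (A⧸J₀)` ⇒ `X₀` lifts to an abelian scheme of relative dimension `g` over `Spec A`.  The `H¹`-count at each rung is ★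
`AbelianVarieties.finrank_cechH1_structureSheaf_eq_dim_of_charZero` for the canonical closed fibre over `κ(A⧸J′)`, of characteristic `0` as an
extension of `κ(A)` (`IsLocalRing.ResidueField.map` of the surjection `A → A⧸J′`).
[cite: Oort1971, Theorem (2.2.1) (p. 273) and pp. 277–280] [cite: MumfordFogartyKirwan1994, Ch. 6 §3 Proposition 6.15]
[cite: MumfordAV1970, §13 Cor. 2 (p. 129)] -/
theorem exists_abelianLift_of_isUnit_two_of_charZero [CharZero (IsLocalRing.ResidueField A)] (J₀ : Ideal A) (hJ₀ : J₀ ≠ ⊤) {g : ℕ}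
    (X₀ : AbelianSchemeOver (Spec (.of (A ⧸ J₀)))) (hg : X₀.IsOfRelDim g) :
    ∃ (X : AbelianSchemeOver (Spec (.of A))) (_ : X.IsOfRelDim g) (G : X₀.X.left ⟶ X.X.left),
      X₀.IsBaseChangeVia X (Spec.map (CommRingCat.ofHom (Ideal.Quotient.mk J₀))) G := by
  -- `2 ∈ Aˣ`: its residue is `2 ≠ 0` in the characteristic-`0` field `κ(A)`
  have h2 : IsUnit (2 : A) := (IsLocalRing.residue_ne_zero_iff_isUnit (2 : A)).mp (by rw [map_ofNat]; exact two_ne_zero)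
  refine exists_abelianLift_of_liftObstructionVanishes J₀ hJ₀ (fun J J' t _ _ _ _ _ _ hI hL hmL φ Y₀ hY₀ => ?_) X₀ hg
  haveI := hI
  have h2' : IsUnit (2 : A ⧸ J') := by simpa only [map_ofNat] using h2.map (Ideal.Quotient.mk J')
  -- `κ(A⧸J′)` is an extension of `κ(A)` along the surjection `A → A⧸J′`, hence of characteristic `0`
  haveI := IsLocalHom.of_surjective (Ideal.Quotient.mk J') Ideal.Quotient.mk_surjective
  haveI : CharZero (IsLocalRing.ResidueField (A ⧸ J')) :=
    charZero_of_injective_ringHom (IsLocalRing.ResidueField.map (Ideal.Quotient.mk J')).injective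
  refine liftObstructionVanishes_of_isUnit_two hL hmL φ Y₀ hY₀ h2' (fun V hV hVcov => ?_)
  exact (Literature.AlgebraicGeometry.AbelianVarieties.finrank_cechH1_structureSheaf_eq_dim_of_charZero
    (closedFibre hL Y₀).toAffine.toAbelianVariety V hV hVcov).2.ge.trans (Nat.le_succ _)

end Literature.AlgebraicGeometry.AbelianSchemes.AbelianSchemeOver

end
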